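import Literature.NumberTheory.GaloisRepresentations.LocalGlobalCohomology
import Mathlib.GroupTheory.SpecificGroups.Cyclic
import Mathlib.GroupTheory.Index
import HarnessLib

/-!
# The STRINGENCY CAP at a rank-one Selmer module: finitely many local sharpenings of a Selmer structure
# cost index `∣ p^{max}`, never `p^{Σ}` — why the Σ-form of crux J (`WildSigmaDivisibilityAtThree`,
# stmt-BirchSwinnertonDyer-20760, SOED) cannot come from local conditions at the Tamagawa carriers
# (route-free algebra; cell `bsd-wall`, D-0131 (3) M-UTD, seat `bsd-wall-utd-p3` gen 4; line `jetchev-max`,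
# stub `stub_beyondMax`; `--supports stmt-BirchSwinnertonDyer-20760`)

Setting (Mazur–Rubin 2004 Def. 2.1.1 = the tree's `DiscreteGaloisModule.SelmerStructure`, `SelmerStructure.selmerGroup`):
`𝓕' ≤ 𝓕` two Selmer structures on a finite Galois module `T` over a number field `K` such that an integer `m`
pushes every local condition of `𝓕` into that of `𝓕'` (`m • 𝓕_v ≤ 𝓕'_v` for all `v`; e.g. `𝓕' = 𝓕` off a finite
set `C` of «carriers» and `[𝓕_v : 𝓕'_v] ∣ p^{n_v}` on `C`, `m = p^{max n_v}`). Then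

* §1 `nsmul_mem_selmerGroup_of_forall_nsmul_mem` — `m • H¹_𝓕(K,T) ≤ H¹_{𝓕'}(K,T)` (no hypothesis on `T`);
* §2 `relIndex_selmerGroup_dvd_of_isAddCyclic` — if `H¹_𝓕(K,T)` is CYCLIC (the stalk of a rank-one Kolyvagin
  system at a core vertex: `H¹_{𝓕(n)}(K, E[p^k])` free of rank `χ = 1` over `ℤ/p^k`, Mazur–Rubin 2004 Def. 4.1.8 and
  Lemma 4.3.2; Howard 2004 §1.6), then `[H¹_𝓕 : H¹_𝓕 ∩ H¹_{𝓕'}] ∣ m`;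
* §3 `relIndex_selmerGroup_dvd_pow_max` / `not_pow_add_dvd_relIndex_selmerGroup` — TWO carriers `v₁, v₂` with
  `p^{n_i} • 𝓕_{v_i} ≤ 𝓕'_{v_i}` and `𝓕_v ≤ 𝓕'_v` elsewhere: the joint index divides `p^{max(n₁,n₂)}` and is NOT
  divisible by `p^{n₁+n₂}` as soon as `1 < p` and `n₁, n₂ ≥ 1` — the pure-algebra core being §0
  (`relIndex_dvd_of_isAddCyclic_of_forall_nsmul_mem`, `not_pow_add_dvd_of_dvd_pow_max`).

READING (why this is filed on J). Jetchev's sharpening of Kolyvagin's bound (Compos. Math. 144 (2008) Thm. 1.4: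
`M_∞ ≥ ord_p c_q` for ONE prime `q ∣ N`, via the STRINGENT Selmer group at `q`, §§4–6) and Büyükboduk's «Tamagawa
defect» (J. Number Theory 129 (2009) Thm. 3.1 = Thm. A/B: the Euler-to-Kolyvagin-system map factors through
`KS(T/𝔪ⁿ, 𝓕_{u-ℓ})`, which vanishes because sharpening the local condition at ONE `ℓ` with `πⁿ ∣ c_ℓ` drops the core
rank from `1` to `0`, Cor. 2.8) both extract the divisibility from a local condition sharpened at ONE carrier.
§2–§3 quantify what SEVERAL simultaneous sharpenings can force on a rank-one (cyclic) Selmer module: index `∣ p^{max}`,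
never `p^{Σ}` — two sharpenings of a cyclic module overlap instead of stacking. So the Σ-form of J (Jetchev
Conj. 1.3 = W. Zhang's refined Kolyvagin conjecture `M_∞ = Σ_ℓ ord_p c_ℓ`; Büyükboduk §4.2 Question 1, there called
«more delicate when there is more than one Tamagawa number which is divisible by p») asserts a divisibility of the
Heegner classes STRICTLY BEYOND what the family of carrier-local conditions forces at the rank-one vertices; its only
proof in print goes through the anticyclotomic main conjecture (Burungale–Castella–Grossi–Skinner, arXiv:2312.09301
Thm. 2, p. 4: «Our proof relies on the cases of the anticyclotomic Main Conjecture established in [BCS]», p > 3), and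
at the additive prime 3 that main-conjecture input is UTD's wall `AdditiveSplitIMCInclusionAtThree` (stmt-20395).
CONSEQUENCE for the line `jetchev-max`: `stub_beyondMax` is not reachable by «multi-prime peeling» of stringent
conditions (steward line L1 «jetchev-multi-stringent» of TRANSFER-JETCHEV-AT3-v1 §4 is capped at max by §3); the
remaining roads are non-local (the IMC ⊇-inclusion = UTD 20395; level-lowering congruences as suggested in
Büyükboduk §4.2, untested at any p).

HONEST FRAMING: elementary algebra over the tree's Selmer-structure vocabulary; proves no stub, closes no item and no
class; it is a kernel-checked NO-GO for one proof strategy (a cap on what carrier-local conditions can yield), not a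
statement about the truth of J. BSD is not proved for any curve by this file. No definition, no named fact, no `sorry`.

References: [MazurRubin2004] Def. 2.1.1 (p. 11), Def. 4.1.8 (p. 38), Lemma 4.3.2 (p. 41); [Howard2004HeegnerKolyvagin]
§1.6; [Jetchev2008] Thm. 1.4, Conj. 1.3, §§4–6 (arXiv:math/0703431); [Buyukboduk2009TamagawaDefect] Thm. A/B (p. 3), Cor. 2.8,
Thm. 3.1 (p. 10), §4.2 Questions 1–2 (p. 12) (arXiv:0710.3858); [BurungaleEtAl2026] Thm. 2
(arXiv:2312.09301 p. 4).
-/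

set_option autoImplicit false
set_option linter.dupNamespace false

universe u

namespace Summit.BirchSwinnertonDyer.BirchSwinnertonDyer.Theorems.StringencyCap

/-! ### §0 Pure algebra: a cyclic group modulo a subgroup containing its `m`-multiples has order `∣ m` -/

section Algebra

variable {A : Type*} [AddCommGroup A]

/-- In an additive group, if every `m`-multiple of `H` lies in `K`, then the index of `K ∩ H` in `H` divides `m`
provided `H` is CYCLIC: the quotient is cyclic and killed by `m`, so its order (= its exponent) divides `m`.
(`AddSubgroup.relIndex K H = [H : K ⊓ H]`.) [folklore; cf. MazurRubin2004, proof of Thm. 4.1.7] -/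
theorem relIndex_dvd_of_isAddCyclic_of_forall_nsmul_mem (H K : AddSubgroup A) [IsAddCyclic H] (m : ℕ)
    (hm : ∀ x ∈ H, m • x ∈ K) : K.relIndex H ∣ m := by
  classical
  -- the quotient `H ⧸ (K restricted to H)` is cyclic and annihilated by `m`
  set K' : AddSubgroup H := K.addSubgroupOf H with hK'
  have hcyc : IsAddCyclic (H ⧸ K') :=
    isAddCyclic_of_surjective (QuotientAddGroup.mk' K') (QuotientAddGroup.mk'_surjective K')
  have hkill : ∀ q : H ⧸ K', m • q = 0 := by
    intro q
    obtain ⟨x, rfl⟩ := QuotientAddGroup.mk'_surjective K' q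
    rw [← map_nsmul, QuotientAddGroup.mk'_apply, QuotientAddGroup.eq_zero_iff]
    simpa [hK', AddSubgroup.mem_addSubgroupOf] using hm x x.2
  have hexp : AddMonoid.exponent (H ⧸ K') ∣ m := AddMonoid.exponent_dvd_of_forall_nsmul_eq_zero hkill
  have hcard : Nat.card (H ⧸ K') = AddMonoid.exponent (H ⧸ K') :=
    (IsAddCyclic.exponent_eq_card).symm
  rw [AddSubgroup.relIndex, AddSubgroup.index, ← hK', hcard]
  exact hexp

/-- Arithmetic of the cap: for `1 < p` and `n₁, n₂ ≥ 1`, `p^{n₁+n₂}` does not divide any divisor `d` of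
`p^{max(n₁,n₂)}` (such a `d` is positive and `≤ p^{max} < p^{n₁+n₂}`). [folklore] -/
theorem not_pow_add_dvd_of_dvd_pow_max {p n₁ n₂ d : ℕ} (hp : 1 < p) (h₁ : 1 ≤ n₁) (h₂ : 1 ≤ n₂)
    (hd : d ∣ p ^ max n₁ n₂) : ¬ p ^ (n₁ + n₂) ∣ d := by
  intro h
  have hd0 : d ≠ 0 := by
    rintro rfl
    exact (pow_ne_zero _ (by omega : p ≠ 0)) (zero_dvd_iff.mp hd)
  have hle : p ^ (n₁ + n₂) ≤ p ^ max n₁ n₂ :=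
    (Nat.le_of_dvd (Nat.pos_of_ne_zero hd0) h).trans (Nat.le_of_dvd (by positivity) hd)
  have hlt : max n₁ n₂ < n₁ + n₂ := by omega
  exact absurd hle (not_le.mpr (Nat.pow_lt_pow_right hp hlt))

end Algebra

/-! ### §1–§3 Selmer structures (the tree's `DiscreteGaloisModule.SelmerStructure`) -/

section Selmer

open NumberField Literature.NumberTheory.GaloisRepresentations
open DiscreteGaloisModule

variable {K : Type u} [Field K] [NumberField K] {M : Type u} [AddCommGroup M]
  [TopologicalSpace M] [DiscreteTopology M] {ρ : DiscreteGaloisModule K M}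

/-- **§1 (no hypothesis on the module).** If an integer `m` pushes every local condition of `𝓕` into that of `𝓕'`
(`m • 𝓕_v ≤ 𝓕'_v` for every place `v`), then `m • H¹_𝓕(K, T) ≤ H¹_{𝓕'}(K, T)`: localisation is additive.
[cite: MazurRubin2004, Def. 2.1.1] -/
theorem nsmul_mem_selmerGroup_of_forall_nsmul_mem (𝓕 𝓕' : SelmerStructure ρ) (m : ℕ)
    (hloc : ∀ v, ∀ x ∈ 𝓕 v, m • x ∈ 𝓕' v) {c : galoisCohomology ρ 1} (hc : c ∈ 𝓕.selmerGroup) :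
    m • c ∈ 𝓕'.selmerGroup := by
  rw [SelmerStructure.mem_selmerGroup_iff] at hc ⊢
  intro v
  rw [map_nsmul]
  exact hloc v _ (hc v)

/-- **§2 THE STRINGENCY CAP.** Same hypothesis, and `H¹_𝓕(K, T)` CYCLIC (a core vertex of a rank-one Kolyvagin system:
`H¹_{𝓕(n)}(K, E[p^k]) ≅ ℤ/p^k`): the index `[H¹_𝓕 : H¹_𝓕 ∩ H¹_{𝓕'}]` divides `m`. With `m = p^{max_v n_v}` over the
carriers this is `p^{max}`, never the `p^{Σ n_v}` that the Σ-form of J would need. [cite: MazurRubin2004, Def. 4.1.8 and Thm. 4.1.7]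
[cite: Buyukboduk2009TamagawaDefect, Thm. A and §4.2 Question 1 (arXiv:0710.3858 pp. 3, 12)] -/
theorem relIndex_selmerGroup_dvd_of_isAddCyclic (𝓕 𝓕' : SelmerStructure ρ) (m : ℕ)
    (hloc : ∀ v, ∀ x ∈ 𝓕 v, m • x ∈ 𝓕' v) [IsAddCyclic 𝓕.selmerGroup] :
    (𝓕'.selmerGroup).relIndex 𝓕.selmerGroup ∣ m :=
  relIndex_dvd_of_isAddCyclic_of_forall_nsmul_mem _ _ m
    fun _ hc => nsmul_mem_selmerGroup_of_forall_nsmul_mem 𝓕 𝓕' m hloc hc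

/-- **§3a Two carriers, cap `p^{max}`.** `𝓕'` agrees with `𝓕` away from two places `v₁, v₂`, where
`p^{n₁} • 𝓕_{v₁} ≤ 𝓕'_{v₁}` and `p^{n₂} • 𝓕_{v₂} ≤ 𝓕'_{v₂}` (e.g. the stringent conditions at two Tamagawa carriers,
`[𝓕_{v_i} : 𝓕'_{v_i}] = p^{n_i}` cyclic); at a cyclic `H¹_𝓕` the joint index divides `p^{max(n₁,n₂)}`.
[cite: Jetchev2008, Thm. 1.4 and §6] [cite: Buyukboduk2009TamagawaDefect, Thm. B] -/
theorem relIndex_selmerGroup_dvd_pow_max (𝓕 𝓕' : SelmerStructure ρ) (p n₁ n₂ : ℕ) (v₁ v₂ : Place K)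
    (hoff : ∀ v, v ≠ v₁ → v ≠ v₂ → 𝓕 v ≤ 𝓕' v)
    (h₁ : ∀ x ∈ 𝓕 v₁, p ^ n₁ • x ∈ 𝓕' v₁) (h₂ : ∀ x ∈ 𝓕 v₂, p ^ n₂ • x ∈ 𝓕' v₂)
    [IsAddCyclic 𝓕.selmerGroup] :
    (𝓕'.selmerGroup).relIndex 𝓕.selmerGroup ∣ p ^ max n₁ n₂ := by
  refine relIndex_selmerGroup_dvd_of_isAddCyclic 𝓕 𝓕' (p ^ max n₁ n₂) fun v x hx => ?_
  by_cases hv₁ : v = v₁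
  · subst hv₁
    have : p ^ max n₁ n₂ • x = p ^ (max n₁ n₂ - n₁) • (p ^ n₁ • x) := by
      rw [← mul_nsmul', ← pow_add, Nat.sub_add_cancel (le_max_left _ _)]
    rw [this]
    exact AddSubgroup.nsmul_mem _ (h₁ x hx) _
  by_cases hv₂ : v = v₂
  · subst hv₂
    have : p ^ max n₁ n₂ • x = p ^ (max n₁ n₂ - n₂) • (p ^ n₂ • x) := by
      rw [← mul_nsmul', ← pow_add, Nat.sub_add_cancel (le_max_right _ _)]
    rw [this]
    exact AddSubgroup.nsmul_mem _ (h₂ x hx) _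
  · exact AddSubgroup.nsmul_mem _ (hoff v hv₁ hv₂ hx) _

/-- **§3b … never `p^{Σ}`.** In §3a with `1 < p` and `n₁, n₂ ≥ 1`, the joint index `[H¹_𝓕 : H¹_𝓕 ∩ H¹_{𝓕'}]` is NOT
divisible by `p^{n₁+n₂}`: two stringencies on a rank-one Selmer module overlap instead of stacking. Hence no argument
that only uses «the Heegner / Kato classes satisfy the stringent local condition at every carrier» can prove the Σ-form
divisibility `M_∞ ≥ Σ_q ord_p c_q` of J — Büyükboduk's Question 1 needs a non-local input (in print: the anticyclotomic
main conjecture, BCGS 2023 Thm. 2). [cite: Buyukboduk2009TamagawaDefect, §4.2 Question 1 (arXiv:0710.3858 p. 12)]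
[cite: BurungaleEtAl2026, Thm. 2 (arXiv:2312.09301 p. 4)] -/
theorem not_pow_add_dvd_relIndex_selmerGroup (𝓕 𝓕' : SelmerStructure ρ) {p n₁ n₂ : ℕ} (hp : 1 < p)
    (hn₁ : 1 ≤ n₁) (hn₂ : 1 ≤ n₂) (v₁ v₂ : Place K)
    (hoff : ∀ v, v ≠ v₁ → v ≠ v₂ → 𝓕 v ≤ 𝓕' v)
    (h₁ : ∀ x ∈ 𝓕 v₁, p ^ n₁ • x ∈ 𝓕' v₁) (h₂ : ∀ x ∈ 𝓕 v₂, p ^ n₂ • x ∈ 𝓕' v₂)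
    [IsAddCyclic 𝓕.selmerGroup] :
    ¬ p ^ (n₁ + n₂) ∣ (𝓕'.selmerGroup).relIndex 𝓕.selmerGroup :=
  not_pow_add_dvd_of_dvd_pow_max hp hn₁ hn₂
    (relIndex_selmerGroup_dvd_pow_max 𝓕 𝓕' p n₁ n₂ v₁ v₂ hoff h₁ h₂)

end Selmer

end Summit.BirchSwinnertonDyer.BirchSwinnertonDyer.Theorems.StringencyCap
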